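import Literature.GroupTheory.ArithmeticGroups.SL2PrimePowTopLayer
import Literature.GroupTheory.ArithmeticGroups.SL2PrimePowDescentLinear
import HarnessLib

/-!
# Central extensions of `SL₂(ℤ/p^e)`: the preimage of the top layer is abelian, and the descent relations

Let `p ≥ 5` be prime, `e ≥ 2`, and let `π : E → SL₂(ℤ/p^e)` be a homomorphism whose kernel is CENTRAL and of
EXPONENT `p` (hypotheses `hcen`, `hexp`; surjectivity is not needed in this file).  Fix `t, l ∈ E` over
`T̄ = (1 1; 0 1)`, `L̄ = (1 0; 1 1)` and put `e₀ = t^{p^{e-1}}`, `f₀ = l^{p^{e-1}}`, `h₁ = t f₀ t⁻¹ f₀⁻¹ e₀` — lifts of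
the basis `ē, f̄, h̄` of the top congruence layer `1 + p^{e-1}𝔰𝔩₂(𝔽_p)` (file `SL2PrimePowTopLayer`).

* `commute_e₀_h₁`, `commute_f₀_h₁`, `commute_e₀_f₀`, `comm_of_layer`: the preimage `A = π⁻¹(layer)` is ABELIAN —
  the commutator pairing would be an `Ad`-invariant alternating form on `𝔰𝔩₂(𝔽_p)` with values in the kernel,
  and there is none for odd `p`; done here by three explicit commutator identities (`commute_conj_comm`).
* `descent_relations`: with a lift `d` of the torus element `diag(2, 2⁻¹)`, the generators `e₀, h₁, f₀` have
  order `p` and are conjugated by `t^{±1}, l^{±1}` EXACTLY according to the adjoint table — the kernel-valued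
  "cocycle constants" vanish.  The proof transports to the additive group `Additive A` and applies the abstract
  linear algebra of `SL2PrimePowDescentLinear` (torus ⇒ `3z' = 0`; `S̄ = T̄⁻¹L̄T̄⁻¹` ⇒ `z'' = 0`).

Sequel (`SL2PrimePowSchurMultiplier`): `W = {e₀^a h₁^b f₀^c}` is then an `E`-normal complement of the kernel inside
`A`, `E/W` is a central exponent-`p` extension of `SL₂(ℤ/p^{e-1})`, and induction on `e` gives the vanishing of the
`p`-primary part of the Schur multiplier of `SL₂(ℤ/p^e)` for `p ≥ 5` [Beyl1986] — the group theory behind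
[CalegariDimitrovTang2025, Cor. 4.5.3] at prime-power level.  No definitions; hypothesis form throughout.
-/

open scoped MatrixGroups
open Matrix Matrix.SpecialLinearGroup

namespace Literature.GroupTheory.ArithmeticGroups

namespace SL2CentralExtension

section anyring
variable {R : Type*} [CommRing R] (ϖ : R)

/-- Matrix identity `T̄ f̄ T̄⁻¹ f̄⁻¹ ē = h̄ = (1+ϖ 0; 0 1-ϖ)` when `ϖ² = 0`. [cite: CalegariDimitrovTang2025,
§4.5, Lemma 4.5.6 and (4.5.8)] -/
theorem coe_hComm (T Eb Fb : SL(2, R)) (hϖ : ϖ * ϖ = 0)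
    (hT : (T : Matrix (Fin 2) (Fin 2) R) = !![1, 1; 0, 1])
    (hE : (Eb : Matrix (Fin 2) (Fin 2) R) = !![1, ϖ; 0, 1])
    (hF : (Fb : Matrix (Fin 2) (Fin 2) R) = !![1, 0; ϖ, 1]) :
    ((T * Fb * T⁻¹ * Fb⁻¹ * Eb : SL(2, R)) : Matrix (Fin 2) (Fin 2) R) = !![1 + ϖ, 0; 0, 1 - ϖ] := by
  have h3 : ϖ * ϖ * ϖ = 0 := by rw [hϖ, zero_mul]
  ext i j; fin_cases i <;> fin_cases j <;>
    simp [hT, hE, hF, Matrix.mul_apply, Fin.sum_univ_two, Matrix.SpecialLinearGroup.coe_inv,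
      Matrix.adjugate_fin_two] <;> grind

end anyring

variable {p e : ℕ} {E : Type*} [Group E] {π : E →* SL(2, ZMod (p ^ e))}

/-- Two elements with the same image under `π` differ by a kernel element (right factor). [cite: Rotman1995, Theorem 7.47] -/
theorem exists_eq_mul_of_map_eq {x y : E} (h : π x = π y) : ∃ z : E, π z = 1 ∧ x = y * z :=
  ⟨y⁻¹ * x, by rw [map_mul, map_inv, h, inv_mul_cancel], by group⟩

section elements

variable (t l : E)
  (ht : ((π t : SL(2, ZMod (p ^ e))) : Matrix (Fin 2) (Fin 2) (ZMod (p ^ e))) = !![1, 1; 0, 1])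
  (hl : ((π l : SL(2, ZMod (p ^ e))) : Matrix (Fin 2) (Fin 2) (ZMod (p ^ e))) = !![1, 0; 1, 1])

include ht in
/-- Image of `e₀ = t^{p^{e-1}}`: the matrix `ē = (1 ϖ; 0 1)`, `ϖ = p^{e-1}`. [cite: CalegariDimitrovTang2025,
§4.5, Lemma 4.5.6 and (4.5.8)] -/
theorem coe_map_e₀ : ((π (t ^ p ^ (e - 1)) : SL(2, ZMod (p ^ e))) : Matrix (Fin 2) (Fin 2) (ZMod (p ^ e))) =
    !![1, (p : ZMod (p ^ e)) ^ (e - 1); 0, 1] := by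
  rw [map_pow, SL2TopLayer.tBar_pow _ ht, Nat.cast_pow]

include hl in
/-- Image of `f₀ = l^{p^{e-1}}`: the matrix `f̄ = (1 0; ϖ 1)`. [cite: CalegariDimitrovTang2025, §4.5, Lemma
4.5.6 and (4.5.8)] -/
theorem coe_map_f₀ : ((π (l ^ p ^ (e - 1)) : SL(2, ZMod (p ^ e))) : Matrix (Fin 2) (Fin 2) (ZMod (p ^ e))) =
    !![1, 0; (p : ZMod (p ^ e)) ^ (e - 1), 1] := by
  rw [map_pow, SL2TopLayer.lBar_pow _ hl, Nat.cast_pow]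

include ht hl in
/-- Image of `h₁ = t f₀ t⁻¹ f₀⁻¹ e₀`: the matrix `h̄ = (1+ϖ 0; 0 1-ϖ)`. [cite: CalegariDimitrovTang2025, §4.5,
Lemma 4.5.6 and (4.5.8)] -/
theorem coe_map_h₁ (he : 2 ≤ e) :
    ((π (t * l ^ p ^ (e - 1) * t⁻¹ * (l ^ p ^ (e - 1))⁻¹ * t ^ p ^ (e - 1)) : SL(2, ZMod (p ^ e))) :
      Matrix (Fin 2) (Fin 2) (ZMod (p ^ e))) =
    !![1 + (p : ZMod (p ^ e)) ^ (e - 1), 0; 0, 1 - (p : ZMod (p ^ e)) ^ (e - 1)] := by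
  simp only [map_mul, map_inv]
  exact coe_hComm _ _ _ _ (SL2TopLayer.varpi_mul_varpi p e he) ht (coe_map_e₀ t ht) (coe_map_f₀ l hl)

end elements

/-- Key commutator identity: if `e₀` commutes with `t` and `[e₀, f₀]` is central, then `e₀` commutes with `t f₀
t⁻¹ f₀⁻¹` (conjugate `u = t f₀ t⁻¹ f₀⁻¹` by `e₀` factor by factor; the central commutator cancels). [cite:
Beyl1986, Theorem (M(SL(2,ℤ/m)) = 0 for 4 ∤ m), p-primary part] -/
theorem commute_conj_comm {t e₀ f₀ : E} (het : Commute e₀ t)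
    (hc : ∀ g : E, g * (e₀ * f₀ * e₀⁻¹ * f₀⁻¹) = (e₀ * f₀ * e₀⁻¹ * f₀⁻¹) * g) :
    Commute e₀ (t * f₀ * t⁻¹ * f₀⁻¹) := by
  set c := e₀ * f₀ * e₀⁻¹ * f₀⁻¹ with hcdef
  have h1 : e₀ * f₀ = c * f₀ * e₀ := by rw [hcdef]; group
  have h2 : e₀ * f₀⁻¹ = f₀⁻¹ * c⁻¹ * e₀ := by rw [hcdef]; group
  have het' : e₀ * t⁻¹ = t⁻¹ * e₀ := by
    have := het.eq
    calc e₀ * t⁻¹ = t⁻¹ * (t * e₀) * t⁻¹ := by group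
      _ = t⁻¹ * (e₀ * t) * t⁻¹ := by rw [this]
      _ = t⁻¹ * e₀ := by group
  rw [commute_iff_eq]
  calc e₀ * (t * f₀ * t⁻¹ * f₀⁻¹) = (e₀ * t) * f₀ * t⁻¹ * f₀⁻¹ := by group
    _ = t * (e₀ * f₀) * t⁻¹ * f₀⁻¹ := by rw [het.eq]; group
    _ = t * (c * f₀ * e₀) * t⁻¹ * f₀⁻¹ := by rw [h1]
    _ = (t * c) * f₀ * (e₀ * t⁻¹) * f₀⁻¹ := by group
    _ = (c * t) * f₀ * (t⁻¹ * e₀) * f₀⁻¹ := by rw [hc t, het']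
    _ = c * t * f₀ * t⁻¹ * (e₀ * f₀⁻¹) := by group
    _ = c * t * f₀ * t⁻¹ * (f₀⁻¹ * c⁻¹ * e₀) := by rw [h2]
    _ = c * (t * f₀ * t⁻¹ * f₀⁻¹ * c⁻¹) * e₀ := by group
    _ = c * (c⁻¹ * (t * f₀ * t⁻¹ * f₀⁻¹)) * e₀ := by
        congr 2
        have := hc (t * f₀ * t⁻¹ * f₀⁻¹)
        calc t * f₀ * t⁻¹ * f₀⁻¹ * c⁻¹ = c⁻¹ * (c * (t * f₀ * t⁻¹ * f₀⁻¹)) * c⁻¹ := by group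
          _ = c⁻¹ * ((t * f₀ * t⁻¹ * f₀⁻¹) * c) * c⁻¹ := by rw [← this]
          _ = c⁻¹ * (t * f₀ * t⁻¹ * f₀⁻¹) := by group
    _ = t * f₀ * t⁻¹ * f₀⁻¹ * e₀ := by group

/-- Cancellation: `a b⁻¹ c⁻¹ a⁻¹ c b = 1` when `a` commutes with `b` and with `c`. [cite: Rotman1995, Theorem 7.47] -/
theorem comm_cancel {G : Type*} [Group G] {a b c : G} (hab : Commute a b) (hac : Commute a c) :
    a * b⁻¹ * c⁻¹ * a⁻¹ * c * b = 1 := by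
  calc a * b⁻¹ * c⁻¹ * a⁻¹ * c * b = b⁻¹ * (a * c⁻¹) * a⁻¹ * c * b := by rw [hab.inv_right.eq]; group
    _ = b⁻¹ * (c⁻¹ * a) * a⁻¹ * c * b := by rw [hac.inv_right.eq]
    _ = 1 := by group

/-- An element killed by `2` and by an odd prime is trivial. [cite: Rotman1995, Theorem 7.47] -/
theorem eq_one_of_sq_of_pow_prime {G : Type*} [Group G] {c : G} {p : ℕ} (hp : p.Prime) (hp2 : p ≠ 2)
    (h2 : c ^ 2 = 1) (hcp : c ^ p = 1) : c = 1 := by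
  have hcop : Nat.Coprime 2 p := (Nat.coprime_primes Nat.prime_two hp).mpr (Ne.symm hp2)
  have h1 : orderOf c ∣ Nat.gcd 2 p := Nat.dvd_gcd (orderOf_dvd_of_pow_eq_one h2) (orderOf_dvd_of_pow_eq_one hcp)
  rw [hcop, Nat.dvd_one] at h1
  exact orderOf_eq_one_iff.mp h1

section commute

variable (hcen : ∀ z : E, π z = 1 → ∀ g : E, g * z = z * g) (hexp : ∀ z : E, π z = 1 → z ^ p = 1)
variable {t l e₀ f₀ h₁ : E} (he₀ : e₀ = t ^ p ^ (e - 1)) (hf₀ : f₀ = l ^ p ^ (e - 1))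
  (hh₁ : h₁ = t * f₀ * t⁻¹ * f₀⁻¹ * e₀)
  (ht : ((π t : SL(2, ZMod (p ^ e))) : Matrix (Fin 2) (Fin 2) (ZMod (p ^ e))) = !![1, 1; 0, 1])
  (hl : ((π l : SL(2, ZMod (p ^ e))) : Matrix (Fin 2) (Fin 2) (ZMod (p ^ e))) = !![1, 0; 1, 1])

include he₀ ht in
/-- Image of `e₀` (hypothesis form). [cite: CalegariDimitrovTang2025, §4.5, Lemma 4.5.6 and (4.5.8)] -/
theorem coe_map_e₀' : ((π e₀ : SL(2, ZMod (p ^ e))) : Matrix (Fin 2) (Fin 2) (ZMod (p ^ e))) =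
    !![1, (p : ZMod (p ^ e)) ^ (e - 1); 0, 1] := by rw [he₀]; exact coe_map_e₀ t ht

include hf₀ hl in
/-- Image of `f₀` (hypothesis form). [cite: CalegariDimitrovTang2025, §4.5, Lemma 4.5.6 and (4.5.8)] -/
theorem coe_map_f₀' : ((π f₀ : SL(2, ZMod (p ^ e))) : Matrix (Fin 2) (Fin 2) (ZMod (p ^ e))) =
    !![1, 0; (p : ZMod (p ^ e)) ^ (e - 1), 1] := by rw [hf₀]; exact coe_map_f₀ l hl

include he₀ hf₀ hh₁ ht hl in
/-- Image of `h₁` (hypothesis form). [cite: CalegariDimitrovTang2025, §4.5, Lemma 4.5.6 and (4.5.8)] -/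
theorem coe_map_h₁' (he : 2 ≤ e) : ((π h₁ : SL(2, ZMod (p ^ e))) : Matrix (Fin 2) (Fin 2) (ZMod (p ^ e))) =
    !![1 + (p : ZMod (p ^ e)) ^ (e - 1), 0; 0, 1 - (p : ZMod (p ^ e)) ^ (e - 1)] := by
  rw [hh₁, he₀, hf₀]; exact coe_map_h₁ t l ht hl he

include hcen he₀ hf₀ ht hl in

/-- The commutator `[e₀, f₀]` lies in the (central) kernel: its image is `[ē, f̄] = 1`. [cite: Beyl1986, Theorem
(M(SL(2,ℤ/m)) = 0 for 4 ∤ m), p-primary part] -/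
theorem comm_e₀_f₀_central (he : 2 ≤ e) (g : E) :
    g * (e₀ * f₀ * e₀⁻¹ * f₀⁻¹) = (e₀ * f₀ * e₀⁻¹ * f₀⁻¹) * g := by
  refine hcen _ ?_ g
  have hEF := SL2TopLayer.eBar_mul_fBar _ (π e₀) (π f₀) (SL2TopLayer.varpi_mul_varpi p e he)
    (coe_map_e₀' he₀ ht) (coe_map_f₀' hf₀ hl)
  rw [map_mul, map_mul, map_mul, map_inv, map_inv, hEF]; group

include hcen he₀ hf₀ hh₁ ht hl in

/-- **`e₀` and `h₁` commute** in any central extension of `SL₂(ℤ/p^e)` (`e ≥ 2`). [cite: Beyl1986, Theorem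
(M(SL(2,ℤ/m)) = 0 for 4 ∤ m), p-primary part] -/
theorem commute_e₀_h₁ (he : 2 ≤ e) : Commute e₀ h₁ := by
  have hu : Commute e₀ (t * f₀ * t⁻¹ * f₀⁻¹) :=
    commute_conj_comm (by rw [he₀]; exact (Commute.refl t).pow_left _)
      (comm_e₀_f₀_central hcen he₀ hf₀ ht hl he)
  rw [hh₁]
  exact hu.mul_right (Commute.refl e₀)

include hcen he₀ hf₀ hh₁ ht hl in

/-- **`f₀` and `h₁` commute**: the symmetric identity for `l` and the fact that `l e₀ l⁻¹ e₀⁻¹ f₀ h₁` lies in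
the kernel (`Ad(L) e = e - h - f`). [cite: Beyl1986, Theorem (M(SL(2,ℤ/m)) = 0 for 4 ∤ m), p-primary part] -/
theorem commute_f₀_h₁ (he : 2 ≤ e) : Commute f₀ h₁ := by
  have hϖ := SL2TopLayer.varpi_mul_varpi p e he
  have hE := coe_map_e₀' he₀ ht
  have hF := coe_map_f₀' hf₀ hl
  have hH := coe_map_h₁' he₀ hf₀ hh₁ ht hl he
  -- `u' := l e₀ l⁻¹ e₀⁻¹` commutes with `f₀`
  have hc' : ∀ g : E, g * (f₀ * e₀ * f₀⁻¹ * e₀⁻¹) = (f₀ * e₀ * f₀⁻¹ * e₀⁻¹) * g := by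
    refine fun g ↦ hcen _ ?_ g
    have hEF := SL2TopLayer.eBar_mul_fBar _ (π e₀) (π f₀) hϖ hE hF
    rw [map_mul, map_mul, map_mul, map_inv, map_inv, ← hEF]; group
  have hu' : Commute f₀ (l * e₀ * l⁻¹ * e₀⁻¹) :=
    commute_conj_comm (by rw [hf₀]; exact (Commute.refl l).pow_left _) hc'
  -- `u' f₀ h₁` is central
  have hz : π (l * e₀ * l⁻¹ * e₀⁻¹ * f₀ * h₁) = 1 := by
    have hLE := SL2TopLayer.lBar_conj_eBar _ (π l) (π e₀) (π f₀) (π h₁) hϖ hl hE hF hH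
    have hEH := SL2TopLayer.eBar_mul_hBar _ (π e₀) (π h₁) hϖ hE hH
    have hEF := SL2TopLayer.eBar_mul_fBar _ (π e₀) (π f₀) hϖ hE hF
    rw [map_mul, map_mul, map_mul, map_mul, map_mul, map_inv, map_inv, hLE]
    exact comm_cancel hEH hEF
  have hcz := hcen _ hz
  -- h₁ = f₀⁻¹ u'⁻¹ ζ with ζ := u' f₀ h₁
  have hh : h₁ = f₀⁻¹ * (l * e₀ * l⁻¹ * e₀⁻¹)⁻¹ * (l * e₀ * l⁻¹ * e₀⁻¹ * f₀ * h₁) := by group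
  rw [hh]
  refine ((Commute.refl f₀).inv_right.mul_right hu'.inv_right).mul_right ?_
  exact (hcz f₀)


include hcen hexp he₀ hf₀ hh₁ ht hl in

/-- **`e₀` and `f₀` commute** (`p` odd, kernel of exponent `p`): conjugating the commuting pair `h₁, f₀` by `t`
shows that `e₀²` commutes with `f₀`, so the central commutator `[e₀, f₀]` has order dividing `2` and `p`.  This
is the vanishing of the invariant alternating form on `𝔰𝔩₂(𝔽_p)`. [cite: Beyl1986, Theorem (M(SL(2,ℤ/m)) = 0 for
4 ∤ m), p-primary part] -/
theorem commute_e₀_f₀ [Fact p.Prime] (he : 2 ≤ e) (hp2 : p ≠ 2) : Commute e₀ f₀ := by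
  have hϖ := SL2TopLayer.varpi_mul_varpi p e he
  have hE := coe_map_e₀' he₀ ht
  have hF := coe_map_f₀' hf₀ hl
  have hH := coe_map_h₁' he₀ hf₀ hh₁ ht hl he
  have heh := commute_e₀_h₁ hcen he₀ hf₀ hh₁ ht hl he
  have hfh := commute_f₀_h₁ hcen he₀ hf₀ hh₁ ht hl he
  -- x := t h₁ t⁻¹ = h₁ e₀⁻¹ e₀⁻¹ ζ₂
  obtain ⟨ζ₂, hζ₂, hx⟩ : ∃ z : E, π z = 1 ∧ t * h₁ * t⁻¹ = h₁ * e₀⁻¹ * e₀⁻¹ * z := by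
    apply exists_eq_mul_of_map_eq
    rw [map_mul, map_mul, map_inv, map_mul, map_mul, map_inv,
      SL2TopLayer.tBar_conj_hBar _ (π t) (π e₀) (π h₁) hϖ ht hE hH]
  have hζc := hcen _ hζ₂
  -- y := t f₀ t⁻¹ = h₁ e₀⁻¹ f₀
  have hy : t * f₀ * t⁻¹ = h₁ * e₀⁻¹ * f₀ := by rw [hh₁]; group
  -- x and y commute
  have hxy : Commute (t * h₁ * t⁻¹) (t * f₀ * t⁻¹) := by
    have := hfh.symm.map (MulAut.conj t)
    simpa [MulAut.conj_apply] using this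
  rw [hx, hy] at hxy
  set a := e₀⁻¹ with ha
  -- extract `a a f₀ = f₀ a a`
  have hah : a * h₁ = h₁ * a := (heh.inv_left).eq
  have hX : Commute h₁ (a * a * ζ₂) :=
    ((heh.inv_left.symm).mul_right heh.inv_left.symm).mul_right (hζc h₁)
  have hY : Commute h₁ (a * f₀) := (heh.inv_left.symm).mul_right hfh.symm
  have key : (a * a * ζ₂) * (a * f₀) = (a * f₀) * (a * a * ζ₂) := by
    have h1 : (h₁ * a * a * ζ₂) * (h₁ * a * f₀) = h₁ * h₁ * ((a * a * ζ₂) * (a * f₀)) := by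
      calc (h₁ * a * a * ζ₂) * (h₁ * a * f₀) = h₁ * ((a * a * ζ₂) * h₁) * (a * f₀) := by group
        _ = h₁ * (h₁ * (a * a * ζ₂)) * (a * f₀) := by rw [hX.eq]
        _ = h₁ * h₁ * ((a * a * ζ₂) * (a * f₀)) := by group
    have h2 : (h₁ * a * f₀) * (h₁ * a * a * ζ₂) = h₁ * h₁ * ((a * f₀) * (a * a * ζ₂)) := by
      calc (h₁ * a * f₀) * (h₁ * a * a * ζ₂) = h₁ * ((a * f₀) * h₁) * (a * a * ζ₂) := by group
        _ = h₁ * (h₁ * (a * f₀)) * (a * a * ζ₂) := by rw [hY.eq]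
        _ = h₁ * h₁ * ((a * f₀) * (a * a * ζ₂)) := by group
    have := hxy.eq
    rw [h1, h2] at this
    exact mul_left_cancel this
  -- cancel ζ₂ and one `a`
  have key2 : a * a * f₀ = f₀ * a * a := by
    have : a * (a * a * f₀) * ζ₂ = a * (f₀ * a * a) * ζ₂ := by
      calc a * (a * a * f₀) * ζ₂ = a * a * a * (f₀ * ζ₂) := by group
        _ = a * a * a * (ζ₂ * f₀) := by rw [hζc f₀]
        _ = a * a * (a * ζ₂) * f₀ := by group
        _ = a * a * (ζ₂ * a) * f₀ := by rw [hζc a]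
        _ = a * a * ζ₂ * (a * f₀) := by group
        _ = a * f₀ * (a * a * ζ₂) := key
        _ = a * (f₀ * a * a) * ζ₂ := by group
    exact mul_left_cancel (mul_right_cancel this)
  -- c₁² = 1
  set c := e₀ * f₀ * e₀⁻¹ * f₀⁻¹ with hc
  have hcc := comm_e₀_f₀_central hcen he₀ hf₀ ht hl he
  have hc2 : c ^ 2 = 1 := by
    have h1 : e₀ * e₀ * f₀ * e₀⁻¹ * e₀⁻¹ = c * c * f₀ := by
      calc e₀ * e₀ * f₀ * e₀⁻¹ * e₀⁻¹ = e₀ * (e₀ * f₀ * e₀⁻¹ * f₀⁻¹ * f₀) * e₀⁻¹ := by group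
        _ = e₀ * (c * f₀) * e₀⁻¹ := by rw [hc]
        _ = (e₀ * c) * f₀ * e₀⁻¹ := by group
        _ = (c * e₀) * f₀ * e₀⁻¹ := by rw [hcc e₀]
        _ = c * (e₀ * f₀ * e₀⁻¹ * f₀⁻¹) * f₀ := by group
        _ = c * c * f₀ := by rw [hc]
    have h2 : e₀ * e₀ * f₀ * e₀⁻¹ * e₀⁻¹ = f₀ := by
      have : f₀ * a * a = a * a * f₀ := key2.symm
      calc e₀ * e₀ * f₀ * e₀⁻¹ * e₀⁻¹ = e₀ * e₀ * (f₀ * a * a) := by rw [ha]; group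
        _ = e₀ * e₀ * (a * a * f₀) := by rw [this]
        _ = f₀ := by rw [ha]; group
    rw [h2] at h1
    have h3 : c * c = 1 := by
      have := h1.symm
      rw [show f₀ = 1 * f₀ from (one_mul f₀).symm] at this
      simpa [mul_assoc] using mul_right_cancel (by simpa [mul_assoc] using this : c * c * f₀ = 1 * f₀)
    rw [sq, h3]
  have hcp : c ^ p = 1 := hexp c (by
    have hEF := SL2TopLayer.eBar_mul_fBar _ (π e₀) (π f₀) hϖ hE hF
    rw [hc, map_mul, map_mul, map_mul, map_inv, map_inv, hEF]; group)
  have hc1 : c = 1 := eq_one_of_sq_of_pow_prime (Fact.out) hp2 hc2 hcp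
  rw [commute_iff_eq]
  calc e₀ * f₀ = (e₀ * f₀ * e₀⁻¹ * f₀⁻¹) * (f₀ * e₀) := by group
    _ = f₀ * e₀ := by rw [← hc, hc1, one_mul]


include he₀ hf₀ hh₁ ht hl in

/-- Every element of the preimage of the top layer is `e₀^b h₁^a f₀^c z` with `z` in the kernel (from the
structure of the layer, `SL2TopLayer.exists_eq_pow_mul_pow_mul_pow`). [cite: CalegariDimitrovTang2025, §4.5,
Lemma 4.5.6 and (4.5.8)] -/
theorem exists_decomp [Fact p.Prime] (he : 2 ≤ e) {x : E}
    (hx : Matrix.SpecialLinearGroup.map (ZMod.castHom (pow_dvd_pow p (Nat.sub_le e 1)) (ZMod (p ^ (e - 1))))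
      (π x) = 1) :
    ∃ (a b c : ℕ) (z : E), π z = 1 ∧ x = e₀ ^ b * h₁ ^ a * f₀ ^ c * z := by
  obtain ⟨a, b, c, habc⟩ := SL2TopLayer.exists_eq_pow_mul_pow_mul_pow p e he (π e₀) (π f₀) (π h₁)
    (coe_map_e₀' he₀ ht) (coe_map_f₀' hf₀ hl) (coe_map_h₁' he₀ hf₀ hh₁ ht hl he) hx
  obtain ⟨z, hz, hxz⟩ := exists_eq_mul_of_map_eq (π := π) (x := x) (y := e₀ ^ b * h₁ ^ a * f₀ ^ c)
    (by rw [habc, map_mul, map_mul, map_pow, map_pow, map_pow])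
  exact ⟨a, b, c, z, hz, hxz⟩

include hcen hexp he₀ hf₀ hh₁ ht hl in

/-- **The preimage of the top congruence layer in a central extension of `SL₂(ℤ/p^e)` by an exponent-`p` group
is abelian** (`p` odd, `e ≥ 2`). [cite: Beyl1986, Theorem (M(SL(2,ℤ/m)) = 0 for 4 ∤ m), p-primary part] -/
theorem comm_of_layer [Fact p.Prime] (he : 2 ≤ e) (hp2 : p ≠ 2) {x y : E}
    (hx : Matrix.SpecialLinearGroup.map (ZMod.castHom (pow_dvd_pow p (Nat.sub_le e 1)) (ZMod (p ^ (e - 1))))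
      (π x) = 1)
    (hy : Matrix.SpecialLinearGroup.map (ZMod.castHom (pow_dvd_pow p (Nat.sub_le e 1)) (ZMod (p ^ (e - 1))))
      (π y) = 1) : x * y = y * x := by
  have heh := commute_e₀_h₁ hcen he₀ hf₀ hh₁ ht hl he
  have hfh := commute_f₀_h₁ hcen he₀ hf₀ hh₁ ht hl he
  have hef := commute_e₀_f₀ hcen hexp he₀ hf₀ hh₁ ht hl he hp2
  obtain ⟨a, b, c, z, hz, rfl⟩ := exists_decomp he₀ hf₀ hh₁ ht hl he hx
  obtain ⟨a', b', c', z', hz', rfl⟩ := exists_decomp he₀ hf₀ hh₁ ht hl he hy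
  -- every generator commutes with every generator
  have hw : ∀ (a b c : ℕ) (w : E), Commute e₀ w → Commute h₁ w → Commute f₀ w →
      Commute (e₀ ^ b * h₁ ^ a * f₀ ^ c) w := fun a b c w h1 h2 h3 ↦
    ((h1.pow_left b).mul_left (h2.pow_left a)).mul_left (h3.pow_left c)
  have hcz : ∀ w : E, Commute z w := fun w ↦ (hcen z hz w).symm
  have hcz' : ∀ w : E, Commute z' w := fun w ↦ (hcen z' hz' w).symm
  have key : Commute (e₀ ^ b * h₁ ^ a * f₀ ^ c * z) (e₀ ^ b' * h₁ ^ a' * f₀ ^ c' * z') := by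
    refine Commute.mul_left ?_ (hcz _)
    refine Commute.mul_right ?_ (hcz' _).symm
    refine hw a b c _ ?_ ?_ ?_
    · exact (hw a' b' c' e₀ (Commute.refl _) heh.symm hef.symm).symm
    · exact (hw a' b' c' h₁ heh (Commute.refl _) hfh).symm
    · exact (hw a' b' c' f₀ hef hfh.symm (Commute.refl _)).symm
  exact key.eq


include he₀ ht in
/-- `e₀` lies over the top layer. [cite: CalegariDimitrovTang2025, §4.5, Lemma 4.5.6 and (4.5.8)] -/
theorem layer_e₀ : Matrix.SpecialLinearGroup.map (ZMod.castHom (pow_dvd_pow p (Nat.sub_le e 1)) (ZMod (p ^ (e - 1))))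
    (π e₀) = 1 :=
  SL2TopLayer.map_castHom_eq_one_of_coe p e (π e₀) (x00 := 0) (x01 := 1) (x10 := 0) (x11 := 0)
    (by rw [coe_map_e₀' he₀ ht]; simp)

include hf₀ hl in
/-- `f₀` lies over the top layer. [cite: CalegariDimitrovTang2025, §4.5, Lemma 4.5.6 and (4.5.8)] -/
theorem layer_f₀ : Matrix.SpecialLinearGroup.map (ZMod.castHom (pow_dvd_pow p (Nat.sub_le e 1)) (ZMod (p ^ (e - 1))))
    (π f₀) = 1 :=
  SL2TopLayer.map_castHom_eq_one_of_coe p e (π f₀) (x00 := 0) (x01 := 0) (x10 := 1) (x11 := 0)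
    (by rw [coe_map_f₀' hf₀ hl]; simp)

include he₀ hf₀ hh₁ ht hl in
/-- `h₁` lies over the top layer. [cite: CalegariDimitrovTang2025, §4.5, Lemma 4.5.6 and (4.5.8)] -/
theorem layer_h₁ (he : 2 ≤ e) :
    Matrix.SpecialLinearGroup.map (ZMod.castHom (pow_dvd_pow p (Nat.sub_le e 1)) (ZMod (p ^ (e - 1)))) (π h₁) = 1 :=
  SL2TopLayer.map_castHom_eq_one_of_coe p e (π h₁) (x00 := 1) (x01 := 0) (x10 := 0) (x11 := -1)
    (by rw [coe_map_h₁' he₀ hf₀ hh₁ ht hl he]; simp [sub_eq_add_neg])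

/-- A kernel element `ζ` (exponent `p`) satisfies `ζ^{p^{e-1}} = 1` for `e ≥ 2`. [cite: Beyl1986, Theorem (M(SL(2,ℤ/m)) = 0 for 4 ∤ m), p-primary part] -/
theorem ker_pow_eq_one (hexp : ∀ z : E, π z = 1 → z ^ p = 1) (he : 2 ≤ e) {z : E} (hz : π z = 1) :
    z ^ p ^ (e - 1) = 1 := by
  obtain ⟨k, hk⟩ := Nat.exists_eq_add_of_le he
  rw [hk, show 2 + k - 1 = 1 + k by omega, pow_add, pow_one, pow_mul, hexp z hz, one_pow]

/-- If `g x g⁻¹ = y ζ` with `ζ` central in the kernel, then `g x^{p^{e-1}} g⁻¹ = y^{p^{e-1}}` (`e ≥ 2`): powers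
wash out the kernel. [cite: Beyl1986, Theorem (M(SL(2,ℤ/m)) = 0 for 4 ∤ m), p-primary part] -/
theorem conj_pow_eq (hcen : ∀ z : E, π z = 1 → ∀ g : E, g * z = z * g) (hexp : ∀ z : E, π z = 1 → z ^ p = 1)
    (he : 2 ≤ e) {g x y z : E} (hz : π z = 1) (hg : g * x * g⁻¹ = y * z) :
    g * x ^ p ^ (e - 1) * g⁻¹ = y ^ p ^ (e - 1) := by
  have h1 : g * x ^ p ^ (e - 1) * g⁻¹ = (g * x * g⁻¹) ^ p ^ (e - 1) := by
    rw [← MulAut.conj_apply, map_pow, MulAut.conj_apply]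
  have hyz : Commute y z := (hcen z hz y : y * z = z * y)
  rw [h1, hg, hyz.mul_pow, ker_pow_eq_one hexp he hz, mul_one]


include hcen hexp he₀ hf₀ hh₁ ht hl in
open scoped IsMulCommutative in

/-- **The descent relations.** In a central extension `π : E → SL₂(ℤ/p^e)` (`p ≥ 5`, `e ≥ 2`, kernel central of
exponent `p`), with `t, l` over `T̄, L̄`, `d` over the torus `diag(2, 2⁻¹)` (`d t d⁻¹ ≡ t⁴`, `d l d⁻¹ ≡ l^b`,
`4b = 1`), `e₀ = t^{p^{e-1}}`, `f₀ = l^{p^{e-1}}`, `h₁ = t f₀ t⁻¹ f₀⁻¹ e₀`: the three generators have order `p`,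
and `t^{±1}`, `l^{±1}` conjugate them EXACTLY by the `𝔰𝔩₂`-table (`t h₁ t⁻¹ = h₁ e₀⁻²`, `l e₀ l⁻¹ = e₀ h₁⁻¹
f₀⁻¹`, `l h₁ l⁻¹ = h₁ f₀²`, …) — no kernel constants survive.  Proof: transport to the additive group of the
(abelian, `comm_of_layer`) layer preimage and apply
`SL2DescentLinear.torsion`/`t_h`/`l_e`/`l_h`/`t_symm`/`l_symm`; the torus kills the `T̄`-constant, `S̄ =
T̄⁻¹L̄T̄⁻¹` the `L̄`-constant. [cite: Beyl1986, Theorem (M(SL(2,ℤ/m)) = 0 for 4 ∤ m), p-primary part] -/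
theorem descent_relations [Fact p.Prime] (hp5 : 5 ≤ p) (he : 2 ≤ e) {d : E} {b : ℕ}
    (hdt : π (d * t * d⁻¹) = π (t ^ 4)) (hdl : π (d * l * d⁻¹) = π (l ^ b))
    (hb : (4 : ZMod (p ^ e)) * (b : ZMod (p ^ e)) = 1) :
    (e₀ ^ p = 1 ∧ h₁ ^ p = 1 ∧ f₀ ^ p = 1) ∧
    t * h₁ * t⁻¹ = h₁ * e₀⁻¹ * e₀⁻¹ ∧ l * e₀ * l⁻¹ = e₀ * h₁⁻¹ * f₀⁻¹ ∧ l * h₁ * l⁻¹ = h₁ * f₀ * f₀ ∧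
    (t⁻¹ * h₁ * t = h₁ * e₀ * e₀ ∧ t⁻¹ * f₀ * t = f₀ * h₁⁻¹ * e₀⁻¹) ∧
    (l⁻¹ * h₁ * l = h₁ * f₀⁻¹ * f₀⁻¹ ∧ l⁻¹ * e₀ * l = e₀ * h₁ * f₀⁻¹) := by
  have hp : p.Prime := Fact.out
  have hp2 : p ≠ 2 := by omega
  have hp3 : p ≠ 3 := by omega
  have hϖ := SL2TopLayer.varpi_mul_varpi p e he
  have hpϖ := SL2TopLayer.natCast_mul_varpi p e (by omega : 1 ≤ e)
  have hE := coe_map_e₀' he₀ ht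
  have hF := coe_map_f₀' hf₀ hl
  have hH := coe_map_h₁' he₀ hf₀ hh₁ ht hl he
  -- the layer preimage
  set A : Subgroup E := ((Matrix.SpecialLinearGroup.map
    (ZMod.castHom (pow_dvd_pow p (Nat.sub_le e 1)) (ZMod (p ^ (e - 1))))).comp π).ker with hAdef
  have memA : ∀ x : E, x ∈ A ↔ Matrix.SpecialLinearGroup.map
      (ZMod.castHom (pow_dvd_pow p (Nat.sub_le e 1)) (ZMod (p ^ (e - 1)))) (π x) = 1 := fun x ↦ by
    rw [hAdef, MonoidHom.mem_ker, MonoidHom.comp_apply]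
  haveI : A.Normal := by rw [hAdef]; infer_instance
  have hA : ∀ x ∈ A, ∀ y ∈ A, x * y = y * x := fun x hx y hy ↦
    comm_of_layer hcen hexp he₀ hf₀ hh₁ ht hl he hp2 ((memA x).mp hx) ((memA y).mp hy)
  haveI : IsMulCommutative A := ⟨⟨fun a b ↦ Subtype.ext (hA _ a.2 _ b.2)⟩⟩
  have heA : e₀ ∈ A := (memA _).mpr (layer_e₀ he₀ ht)
  have hfA : f₀ ∈ A := (memA _).mpr (layer_f₀ hf₀ hl)
  have hhA : h₁ ∈ A := (memA _).mpr (layer_h₁ he₀ hf₀ hh₁ ht hl he)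
  have hzA : ∀ z : E, π z = 1 → z ∈ A := fun z hz ↦ (memA _).mpr (by rw [hz, map_one])
  -- additive model
  let ψ : E → (Additive A ≃+ Additive A) := fun g ↦ MulEquiv.toAdditive (MulAut.conjNormal g)
  have hψ : ∀ (g : E) (a : A), ((Additive.toMul (ψ g (Additive.ofMul a)) : A) : E) = g * a * g⁻¹ :=
    fun g a ↦ MulAut.conjNormal_apply g a
  have hcomp : ∀ (g g' : E) (v : Additive A), ψ (g * g') v = ψ g (ψ g' v) := by
    intro g g' v
    show MulEquiv.toAdditive (MulAut.conjNormal (g * g')) v = _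
    rw [map_mul]; rfl
  have hsymm : ∀ (g : E) (v : Additive A), (ψ g).symm v = ψ g⁻¹ v := by
    intro g v
    show (MulEquiv.toAdditive (MulAut.conjNormal g)).symm v = MulEquiv.toAdditive (MulAut.conjNormal g⁻¹) v
    rw [map_inv]; rfl
  let eV : Additive A := Additive.ofMul ⟨e₀, heA⟩
  let hV : Additive A := Additive.ofMul ⟨h₁, hhA⟩
  let fV : Additive A := Additive.ofMul ⟨f₀, hfA⟩
  let Z : AddSubgroup (Additive A) := (Subgroup.toAddSubgroup ((π.comp A.subtype).ker))
  have memZ : ∀ v : Additive A, v ∈ Z ↔ π ((Additive.toMul v : A) : E) = 1 := fun v ↦ by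
    show Additive.toMul v ∈ (π.comp A.subtype).ker ↔ _
    rw [MonoidHom.mem_ker, MonoidHom.comp_apply, Subgroup.coe_subtype]
  -- a criterion for equalities in the additive model
  have crit : ∀ (v w : Additive A), ((Additive.toMul v : A) : E) = ((Additive.toMul w : A) : E) → v = w :=
    fun v w h ↦ Additive.toMul.injective (Subtype.ext h)
  have coe_e : ((Additive.toMul eV : A) : E) = e₀ := rfl
  have coe_h : ((Additive.toMul hV : A) : E) = h₁ := rfl
  have coe_f : ((Additive.toMul fV : A) : E) = f₀ := rfl
  -- (Z) facts
  have pZ : ∀ v ∈ Z, p • v = 0 := fun v hv ↦ crit _ _ (by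
    rw [toMul_nsmul, Subgroup.coe_pow, toMul_zero, Subgroup.coe_one]; exact hexp _ ((memZ v).mp hv))
  have fixall : ∀ (g : E), π g = 1 → ∀ v : Additive A, ψ g v = v := fun g hg v ↦ crit _ _ (by
    rw [show v = Additive.ofMul (Additive.toMul v) from rfl, hψ]
    rw [toMul_ofMul, ← hcen g hg, mul_inv_cancel_right])
  have fixg : ∀ (g : E), ∀ v ∈ Z, ψ g v = v := fun g v hv ↦ crit _ _ (by
    rw [show v = Additive.ofMul (Additive.toMul v) from rfl, hψ, toMul_ofMul,
      hcen _ ((memZ v).mp hv) g, mul_inv_cancel_right])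
  -- p-th powers are central
  have pe : p • eV ∈ Z := (memZ _).mpr (by
    rw [toMul_nsmul, Subgroup.coe_pow, coe_e, map_pow]; exact SL2TopLayer.eBar_pow_p _ p hpϖ _ hE)
  have pf : p • fV ∈ Z := (memZ _).mpr (by
    rw [toMul_nsmul, Subgroup.coe_pow, coe_f, map_pow]; exact SL2TopLayer.fBar_pow_p _ p hpϖ _ hF)
  have ph : p • hV ∈ Z := (memZ _).mpr (by
    rw [toMul_nsmul, Subgroup.coe_pow, coe_h, map_pow]; exact SL2TopLayer.hBar_pow_p _ p hϖ hpϖ _ hH)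
  -- t-relations
  have te : ψ t eV = eV := crit _ _ (by rw [hψ]; change t * e₀ * t⁻¹ = e₀; rw [he₀]; group)
  have tf : ψ t fV = hV - eV + fV := crit _ _ (by
    rw [hψ, toMul_add, toMul_sub, Subgroup.coe_mul, Subgroup.coe_div, coe_e, coe_h, coe_f]
    change t * f₀ * t⁻¹ = _
    rw [hh₁]; simp only [div_eq_mul_inv]; group)
  have th : ψ t hV - (hV - 2 • eV) ∈ Z := (memZ _).mpr (by
    rw [toMul_sub, toMul_sub, toMul_nsmul, Subgroup.coe_div, Subgroup.coe_div, Subgroup.coe_pow, hψ,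
      coe_e, coe_h]
    change π (t * h₁ * t⁻¹ / (h₁ / e₀ ^ 2)) = 1
    rw [map_div, map_div, map_mul, map_mul, map_inv, map_pow,
      SL2TopLayer.tBar_conj_hBar _ (π t) (π e₀) (π h₁) hϖ ht hE hH]
    simp only [div_eq_mul_inv]; group)
  -- the element s = t⁻¹ l t⁻¹
  set sE : E := t⁻¹ * l * t⁻¹ with hsE
  have hst : π (sE * t * sE⁻¹) = π l⁻¹ := by
    simp only [hsE, map_mul, map_inv]
    exact SL2TopLayer.sBar_conj_tBar (π t) (π l) ht hl
  have hsl : π (sE * l * sE⁻¹) = π t⁻¹ := by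
    simp only [hsE, map_mul, map_inv]
    exact SL2TopLayer.sBar_conj_lBar (π t) (π l) ht hl
  obtain ⟨ζt, hζt, hstζ⟩ := exists_eq_mul_of_map_eq hst
  obtain ⟨ζl, hζl, hslζ⟩ := exists_eq_mul_of_map_eq hsl
  have se : ψ sE eV = -fV := crit _ _ (by
    rw [hψ, toMul_neg, Subgroup.coe_inv, coe_f]
    change sE * e₀ * sE⁻¹ = f₀⁻¹
    rw [he₀, hf₀, conj_pow_eq hcen hexp he hζt hstζ, inv_pow])
  have sf : ψ sE fV = -eV := crit _ _ (by
    rw [hψ, toMul_neg, Subgroup.coe_inv, coe_e]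
    change sE * f₀ * sE⁻¹ = e₀⁻¹
    rw [he₀, hf₀, conj_pow_eq hcen hexp he hζl hslζ, inv_pow])
  have hs : ∀ v, ψ sE v = (ψ t).symm (ψ l ((ψ t).symm v)) := fun v ↦ by
    simp only [hsymm]
    rw [← hcomp, ← hcomp, hsE, mul_assoc]
  have hl' : ∀ v, ψ l v = ψ t (ψ sE (ψ t v)) := fun v ↦ by
    rw [← hcomp, ← hcomp, hsE]
    congr 2; group
  -- the torus element d
  obtain ⟨ζd, hζd, hdtζ⟩ := exists_eq_mul_of_map_eq hdt
  obtain ⟨ζd', hζd', hdlζ⟩ := exists_eq_mul_of_map_eq hdl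
  have de : ψ d eV = 4 • eV := crit _ _ (by
    rw [hψ, toMul_nsmul, Subgroup.coe_pow, coe_e]
    change d * e₀ * d⁻¹ = e₀ ^ 4
    rw [he₀, conj_pow_eq hcen hexp he hζd hdtζ, ← pow_mul, ← pow_mul, mul_comm])
  have df : ψ d fV = b • fV := crit _ _ (by
    rw [hψ, toMul_nsmul, Subgroup.coe_pow, coe_f]
    change d * f₀ * d⁻¹ = f₀ ^ b
    rw [hf₀, conj_pow_eq hcen hexp he hζd' hdlζ, ← pow_mul, ← pow_mul, mul_comm])
  have hbk : 4 * b = (4 * b / p ^ e * p ^ (e - 1)) * p + 1 := by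
    haveI : NeZero (p ^ e) := ⟨pow_ne_zero _ hp.ne_zero⟩
    have h1 : ((4 * b : ℕ) : ZMod (p ^ e)) = ((1 : ℕ) : ZMod (p ^ e)) := by push_cast; exact hb
    rw [ZMod.natCast_eq_natCast_iff'] at h1
    have hpe : 1 < p ^ e := Nat.one_lt_pow (by omega) hp.one_lt
    rw [Nat.mod_eq_of_lt hpe] at h1
    have h2 := Nat.div_add_mod (4 * b) (p ^ e)
    rw [h1] at h2
    obtain ⟨k, hk⟩ := Nat.exists_eq_add_of_le he
    have hpow : p ^ e = p ^ (e - 1) * p := by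
      rw [hk, show 2 + k - 1 = 1 + k by omega, show 2 + k = (1 + k) + 1 by omega, pow_succ]
    rw [mul_assoc, ← hpow]
    linarith [h2]
  have dt : ∀ v, ψ d (ψ t v) = ψ t (ψ t (ψ t (ψ t (ψ d v)))) := fun v ↦ by
    have hdt' : d * t = t ^ 4 * ζd * d := by
      calc d * t = (d * t * d⁻¹) * d := by group
        _ = t ^ 4 * ζd * d := by rw [hdtζ]
    rw [← hcomp, hdt', hcomp, hcomp, fixall ζd hζd, show (4 : ℕ) = 1 + 1 + 1 + 1 from rfl, pow_succ,
      pow_succ, pow_succ, pow_one, hcomp, hcomp, hcomp]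
  -- l-relations
  have lf : ψ l fV = fV := crit _ _ (by rw [hψ]; change l * f₀ * l⁻¹ = f₀; rw [hf₀]; group)
  have lh : ψ l hV - (hV + 2 • fV) ∈ Z := (memZ _).mpr (by
    rw [toMul_sub, toMul_add, toMul_nsmul, Subgroup.coe_div, Subgroup.coe_mul, Subgroup.coe_pow, hψ,
      coe_f, coe_h]
    change π (l * h₁ * l⁻¹ / (h₁ * f₀ ^ 2)) = 1
    rw [map_div, map_mul, map_mul, map_mul, map_inv, map_pow,
      SL2TopLayer.lBar_conj_hBar _ (π l) (π f₀) (π h₁) hϖ hl hF hH]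
    simp only [div_eq_mul_inv]; group)
  -- apply the additive core
  have le := SL2DescentLinear.l_e (ψ t) (ψ l) (ψ sE) eV hV fV te tf se hl'
  obtain ⟨pe0, ph0, pf0⟩ := SL2DescentLinear.torsion hp hp2 (ψ t) (ψ l) eV hV fV Z pZ (fixg t) (fixg l)
    pe ph pf tf th le
  set z' := ψ t hV - (hV - 2 • eV) with hz'def
  have th_eq : ψ t hV = hV - 2 • eV + z' := by rw [hz'def]; abel
  have th' := SL2DescentLinear.t_h hp hp3 (ψ t) (ψ d) eV hV fV z' Z pZ (fixg t) (fixg d) th pe0 ph0 te tf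
    th_eq de df hbk dt
  set z'' := ψ l hV - (hV + 2 • fV) with hz''def
  have lh_eq : ψ l hV = hV + 2 • fV + z'' := by rw [hz''def]; abel
  have lh' := SL2DescentLinear.l_h (ψ t) (ψ l) (ψ sE) eV hV fV z'' te tf th' lf le lh_eq sf hs
  obtain ⟨tse, tsh, tsf⟩ := SL2DescentLinear.t_symm (ψ t) eV hV fV te tf th'
  obtain ⟨lsf, lsh, lse⟩ := SL2DescentLinear.l_symm (ψ l) eV hV fV lf le lh'
  -- translate back
  have back : ∀ {v w : Additive A}, v = w → ((Additive.toMul v : A) : E) = ((Additive.toMul w : A) : E) :=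
    fun h ↦ by rw [h]
  refine ⟨⟨?_, ?_, ?_⟩, ?_, ?_, ?_, ⟨?_, ?_⟩, ⟨?_, ?_⟩⟩
  · have := back pe0
    rwa [toMul_nsmul, Subgroup.coe_pow, coe_e, toMul_zero, Subgroup.coe_one] at this
  · have := back ph0
    rwa [toMul_nsmul, Subgroup.coe_pow, coe_h, toMul_zero, Subgroup.coe_one] at this
  · have := back pf0
    rwa [toMul_nsmul, Subgroup.coe_pow, coe_f, toMul_zero, Subgroup.coe_one] at this
  · have := back th'
    rw [hψ, toMul_sub, toMul_nsmul, Subgroup.coe_div, Subgroup.coe_pow, coe_h, coe_e] at this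
    change t * h₁ * t⁻¹ = _ at this
    rw [this]; simp only [div_eq_mul_inv]; group
  · have := back le
    rw [hψ, toMul_sub, toMul_sub, Subgroup.coe_div, Subgroup.coe_div, coe_h, coe_e, coe_f] at this
    change l * e₀ * l⁻¹ = _ at this
    rw [this]; simp only [div_eq_mul_inv]
  · have := back lh'
    rw [hψ, toMul_add, toMul_nsmul, Subgroup.coe_mul, Subgroup.coe_pow, coe_h, coe_f] at this
    change l * h₁ * l⁻¹ = _ at this
    rw [this, sq, ← mul_assoc]
  · have := back tsh
    rw [hsymm, hψ, toMul_add, toMul_nsmul, Subgroup.coe_mul, Subgroup.coe_pow, coe_h, coe_e] at this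
    change t⁻¹ * h₁ * t⁻¹⁻¹ = _ at this
    rw [inv_inv] at this
    rw [this, sq, ← mul_assoc]
  · have := back tsf
    rw [hsymm, hψ, toMul_sub, toMul_sub, Subgroup.coe_div, Subgroup.coe_div, coe_h, coe_e, coe_f] at this
    change t⁻¹ * f₀ * t⁻¹⁻¹ = _ at this
    rw [inv_inv] at this
    rw [this]; simp only [div_eq_mul_inv]
  · have := back lsh
    rw [hsymm, hψ, toMul_sub, toMul_nsmul, Subgroup.coe_div, Subgroup.coe_pow, coe_h, coe_f] at this
    change l⁻¹ * h₁ * l⁻¹⁻¹ = _ at this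
    rw [inv_inv] at this
    rw [this]; simp only [div_eq_mul_inv]; group
  · have := back lse
    rw [hsymm, hψ, toMul_sub, toMul_add, Subgroup.coe_div, Subgroup.coe_mul, coe_h, coe_e, coe_f] at this
    change l⁻¹ * e₀ * l⁻¹⁻¹ = _ at this
    rw [inv_inv] at this
    rw [this]; simp only [div_eq_mul_inv]

end commute

end SL2CentralExtension

end Literature.GroupTheory.ArithmeticGroups
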